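import Summits.QuantumFields.YangMills.Theorems.IR.DeconfinementRulerHelpers
import Summits.QuantumFields.YangMills.Theorems.BalabanLadderIRcofCentreFinite
import Summits.QuantumFields.YangMills.Theorems.BalabanLadderIRRankPurityCofinalDefs
import Summits.QuantumFields.YangMills.Theses.BalabanLadder
import Literature.MathematicalPhysics.QuantumFieldTheory.WilsonFinTorusTwistedPartitionSwap
import Literature.MathematicalPhysics.QuantumFieldTheory.WilsonFinTorusPartitionSymmetry
import Literature.MathematicalPhysics.QuantumFieldTheory.WilsonFinTorusSpectralData
import HarnessLib

/-!
# LENS-1 g2 «FEMTO→BULK TRANSFER» sheet for crux `IRcof` (stmt-QuantumFields-26930) — THE IN-PLANE SQUARING LADDER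
# (area-law bookkeeping): the F-half of (G) = `ConfinementHeredityUp` becomes a theorem modulo ONE located operator lemma

D-0171 node (ideator ymfull-r2c-lens-1 g2, lens «femto→bulk transfer», provocation «recent-theorem open-question harvest»).
HONEST FRAMING: finite-volume ∕ conditional bookkeeping over the tree's Wilson finite-torus partition functions; NOTHING here
proves PXcof, `IRcof`, `IR`, or the Yang–Mills mass gap (Clay; NOT proved anywhere in this tree; R4 closes only the conditional
finite-𝕋⁴ rung `BalabanLadder.UV`).  The pieces (S) Seed, (Σ) FluxSubmult, (R) Residuals, (V) NeutralPure, (CF) CentreFreePX are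
HYPOTHESES (typed `def … : Prop`, no `sorry`); what is PROVED is the plumbing
`Seed → FluxSubmult → Residuals → NeutralPure → CentreFreePX → PXcof(1∕24)` (`pxcof24_of_pieces`) and
`… → IRnscCof → BalabanLadder.IRcof` BY NAME (`IRcof_of_pieces`, the slot kernel `PinnedExitCofinal.cofinalGapOn_of_pinnedExits`).

THE LEVER (one move): for the flux weight `u := 1 − P∕Z` of one temporal plane (`P` = the `⟨g⟩`-average of the `(0,3)`-twisted
partition functions = the trace over the electric-flux sectors neutral in direction `0`), DOUBLING AN IN-PLANE SIDE SQUARES `u`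
(`u(2τ) ≤ u(τ)²·R`, `R = Z(τ)²∕Z(2τ)` the untwisted doubling ratio — this is the area law as a recursion; it rests on the located lemma
(Σ) «flux-sector sub-multiplicativity in time» `Z(2τ) − P(2τ) ≤ (Z(τ) − P(τ))²`, i.e. `Tr Π T^{2τ} ≤ (Tr Π T^τ)²` for the positive
transfer matrix restricted to the charged sectors), while DOUBLING A TRANSVERSE SIDE AT MOST DOUBLES IT (`u(2b) ≤ 2u(b) + δ^{tw}`,
PROVED here from `Z(2b) ≤ Z(b)²` alone).  One octave (all four sides doubled: time, axis 1, axis 2, axis 0) maps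
`u ↦ (8u² + 3u + 3ē)²·6∕5 ≤ u∕2 + ē∕2` below the ignition threshold `u ≤ 1∕32` (`arith_contract`): margin confinement of ONE cold `4:1`
box is HEREDITARY UPWARD and improves geometrically, so five octaves above a `1∕32`-margin-confined pinned box the flux weight is `≤ 1∕400`,
and the seam `coldDefect ≤ θ_V + 2u` (`coldDefect_le_of_neutralPure`) turns (V) neutral purity `θ_V = 1∕60` into THE NUMBER `1∕24`.

PIECE TAGS (critic GRID v4 conventions): (S) `Seed` = (CU)(1∕32) ∧ `4 ∣ L` VERBATIM SHAPE of row 42's `PinnedConfinedCofinal` — UNDECIDED,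
E-type, instrument-facing (the ignition: one margin-confined cold `4:1` box cofinally, pinned in fm; implied by PXcof(1∕64) at scales `4 ∣ L` via
S1 `half_twist_cost_le_coldDefect`, so WEAKER-in-kind than the slot); (Σ) `FluxSubmult` — ATTACKABLE (M): the charged-sector analogue of
`wilsonFinTorusPartition_two_mul_le_sq` via a centre-adapted eigenbasis (`exists_eigenbasis_finTorusSliceKernel` + simultaneous
diagonalisation of the commuting centre action); group-blind, width 0; (R) `Residuals` — UNDECIDED, near-wall only at the seed octave
(half-purity of the seed box in time, `6∕5`-purity of one in-plane spatial doubling, transverse twisted-doubling defects `≤ u + 10⁻³`),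
exponentially idle above it; (V) `NeutralPure` — UNDECIDED, E-type but CENTRE-BLIND (glueball gap of the direction-0-neutral sector, asked only
where the flux weight is already `≤ 1∕400`, i.e. ≥ 2 octaves above the confinement scale); (CF) `CentreFreePX` — the slot itself restricted to
centre-free `G` (= row 13's `CentreFreeResidual`; this lens has no purchase there: THE NUMBER is all-V, X11).
LEAVES: (Σ) ATTACKABLE now; (S),(R),(V) INSTRUMENTABLE (GUIDANCE: single-plane twist ratios on `(L,L,L,L∕4)` vs the four octave boxes);
(CF) BARRIER-class (X11) — imported, not attacked.
-/

set_option autoImplicit false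

noncomputable section

open Filter Topology MeasureTheory
open scoped BigOperators
open Literature.MathematicalPhysics.QuantumFieldTheory Literature.MathematicalPhysics.QuantumLattice
open Summit.QuantumFields.YangMills.Cruxes.OSLegsFromFemtoAndGap.DlrCollarTransfer (LowerBounds)
open Summit.QuantumFields.YangMills.Cruxes.IR.ColdPurityBridge (coldDefect)
open Summit.QuantumFields.YangMills.Cruxes.IR.RankPurity (IRnscCof)
open Summit.QuantumFields.YangMills.Cruxes.IR.PinnedExitCofinal (cofinalGapOn_of_pinnedExits)
open Summit.QuantumFields.YangMills.Cruxes.IR.TwistCost (twistedPartition_le)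

namespace Summit.QuantumFields.YangMills.Cruxes.IRcof.FemtoBulkG2

/-! ## §A Real arithmetic of the ladder (fully proved) -/

/-- TRANSVERSE arithmetic: `Z₂ ≤ Z₁²`, `(1−e)·P₁² ≤ P₂`, `0 ≤ P₁ ≤ Z₁` ⟹ `1 − P₂∕Z₂ ≤ 2(1 − P₁∕Z₁) + e`. -/
theorem arith_transverse {Z₁ Z₂ P₁ P₂ e : ℝ} (hZ₁ : 0 < Z₁) (hZ₂ : 0 < Z₂) (hP₁0 : 0 ≤ P₁) (hP₁ : P₁ ≤ Z₁)
    (hP₂0 : 0 ≤ P₂) (he : 0 ≤ e) (hdbl : Z₂ ≤ Z₁ ^ 2) (hres : (1 - e) * P₁ ^ 2 ≤ P₂) :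
    1 - P₂ / Z₂ ≤ 2 * (1 - P₁ / Z₁) + e := by
  have hq : P₁ / Z₁ ≤ 1 := by rwa [div_le_one hZ₁]
  have hq0 : 0 ≤ P₁ / Z₁ := div_nonneg hP₁0 hZ₁.le
  have h1 : P₂ / Z₁ ^ 2 ≤ P₂ / Z₂ := div_le_div_of_nonneg_left hP₂0 hZ₂ hdbl
  have h2 : (1 - e) * (P₁ / Z₁) ^ 2 ≤ P₂ / Z₁ ^ 2 := by
    rw [div_pow, ← mul_div_assoc]
    exact div_le_div_of_nonneg_right hres (by positivity)
  have h3 : 0 ≤ e * (1 - (P₁ / Z₁) ^ 2) := mul_nonneg he (by nlinarith)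
  nlinarith [sq_nonneg (P₁ / Z₁ - 1)]

/-- IN-PLANE arithmetic: `Z₂ − P₂ ≤ (Z₁ − P₁)²` (sector sub-multiplicativity) and `Z₁² ≤ 𝒩·Z₂` (doubling ratio) ⟹
`1 − P₂∕Z₂ ≤ (1 − P₁∕Z₁)²·𝒩` — the squaring. -/
theorem arith_inplane {Z₁ Z₂ P₁ P₂ 𝒩 : ℝ} (hZ₁ : 0 < Z₁) (hZ₂ : 0 < Z₂)
    (hsub : Z₂ - P₂ ≤ (Z₁ - P₁) ^ 2) (hres : Z₁ ^ 2 ≤ 𝒩 * Z₂) :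
    1 - P₂ / Z₂ ≤ (1 - P₁ / Z₁) ^ 2 * 𝒩 := by
  have e1 : 1 - P₂ / Z₂ = (Z₂ - P₂) / Z₂ := by field_simp
  have e2 : 1 - P₁ / Z₁ = (Z₁ - P₁) / Z₁ := by field_simp
  rw [e1, e2, div_le_iff₀ hZ₂]
  calc Z₂ - P₂ ≤ (Z₁ - P₁) ^ 2 := hsub
    _ = ((Z₁ - P₁) / Z₁) ^ 2 * Z₁ ^ 2 := by field_simp
    _ ≤ ((Z₁ - P₁) / Z₁) ^ 2 * (𝒩 * Z₂) := mul_le_mul_of_nonneg_left hres (sq_nonneg _)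
    _ = ((Z₁ - P₁) / Z₁) ^ 2 * 𝒩 * Z₂ := by ring

/-- SEAM arithmetic: `P₂ ≤ Z₂`, `(1−θ)·P₁² ≤ P₂`, `0 ≤ P₁ ≤ Z₁`, `0 ≤ θ` ⟹ `1 − Z₂∕Z₁² ≤ θ + 2(1 − P₁∕Z₁)`. -/
theorem arith_seam {Z₁ Z₂ P₁ P₂ θ : ℝ} (hZ₁ : 0 < Z₁) (hP₁0 : 0 ≤ P₁) (hP₁ : P₁ ≤ Z₁)
    (hP₂ : P₂ ≤ Z₂) (hθ : 0 ≤ θ) (hV : (1 - θ) * P₁ ^ 2 ≤ P₂) :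
    1 - Z₂ / Z₁ ^ 2 ≤ θ + 2 * (1 - P₁ / Z₁) := by
  have hq : P₁ / Z₁ ≤ 1 := by rwa [div_le_one hZ₁]
  have hq0 : 0 ≤ P₁ / Z₁ := div_nonneg hP₁0 hZ₁.le
  have h2 : (1 - θ) * (P₁ / Z₁) ^ 2 ≤ Z₂ / Z₁ ^ 2 := by
    rw [div_pow, ← mul_div_assoc]
    exact div_le_div_of_nonneg_right (hV.trans hP₂) (by positivity)
  have h3 : 0 ≤ θ * (1 - (P₁ / Z₁) ^ 2) := mul_nonneg hθ (by nlinarith)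
  nlinarith [sq_nonneg (P₁ / Z₁ - 1)]

/-- OCTAVE arithmetic (schedule time, axis 1, axis 2, axis 0): `u₄ ≤ (8u² + 3u + 3e)²·6∕5`. -/
theorem arith_octave {u u₁ u₂ u₃ u₄ e : ℝ} (_hu : 0 ≤ u) (hu₃ : 0 ≤ u₃) (_he : 0 ≤ e)
    (h1 : u₁ ≤ u ^ 2 * 2) (h2 : u₂ ≤ 2 * u₁ + (u + e)) (h3 : u₃ ≤ 2 * u₂ + (u + e))
    (h4 : u₄ ≤ u₃ ^ 2 * (6 / 5)) :
    u₄ ≤ (8 * u ^ 2 + 3 * u + 3 * e) ^ 2 * (6 / 5) := by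
  have h3' : u₃ ≤ 8 * u ^ 2 + 3 * u + 3 * e := by nlinarith
  have h5 : u₃ ^ 2 ≤ (8 * u ^ 2 + 3 * u + 3 * e) ^ 2 := pow_le_pow_left₀ hu₃ h3' 2
  nlinarith

/-- CONTRACTION below the ignition threshold: `0 ≤ u ≤ 1∕32`, `0 ≤ e ≤ 10⁻³` ⟹ `(8u² + 3u + 3e)²·6∕5 ≤ u∕2 + e∕2`. -/
theorem arith_contract {u e : ℝ} (hu : 0 ≤ u) (hu' : u ≤ 1 / 32) (he : 0 ≤ e) (he' : e ≤ 1 / 1000) :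
    (8 * u ^ 2 + 3 * u + 3 * e) ^ 2 * (6 / 5) ≤ u / 2 + e / 2 := by
  have hu2 : u ^ 2 ≤ u * (1 / 32) := by nlinarith
  have hx0 : 0 ≤ 8 * u ^ 2 + 3 * u + 3 * e := by positivity
  have hxle : 8 * u ^ 2 + 3 * u + 3 * e ≤ 1 / 8 := by nlinarith
  have hxx : (8 * u ^ 2 + 3 * u + 3 * e) ^ 2 ≤ (8 * u ^ 2 + 3 * u + 3 * e) * (1 / 8) := by
    rw [sq]; exact mul_le_mul_of_nonneg_left hxle hx0
  nlinarith

/-! ## §B Currency: the `(0,3)`-twist family, the direction-`0`-neutral partition function `P0`, the flux weight `u0` -/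

section Currency

variable {G : Type} [Group G] [TopologicalSpace G] [IsTopologicalGroup G] [CompactSpace G]
  [MeasurableSpace G] [BorelSpace G]

/-- The temporal twist family «`g` on the plane `(0,3)`, nothing else»: `(g, 1, 1, 1)`. -/
def tw0 (g : G) : Fin 4 → G := Function.update (1 : Fin 4 → G) 0 g

omit [TopologicalSpace G] [IsTopologicalGroup G] [CompactSpace G] [MeasurableSpace G] [BorelSpace G] in
theorem tw0_apply_zero (g : G) : tw0 g 0 = g := by
  simp [tw0]

omit [TopologicalSpace G] [IsTopologicalGroup G] [CompactSpace G] [MeasurableSpace G] [BorelSpace G] in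
theorem tw0_apply_of_ne (g : G) {μ : Fin 4} (h : μ ≠ 0) : tw0 g μ = 1 := by
  simp [tw0, h]

omit [TopologicalSpace G] [IsTopologicalGroup G] [CompactSpace G] [MeasurableSpace G] [BorelSpace G] in
/-- A central `g` gives a central family. -/
theorem tw0_center {g : G} (hg : g ∈ Subgroup.center G) (μ : Fin 4) : tw0 g μ ∈ Subgroup.center G := by
  rcases eq_or_ne μ 0 with rfl | h
  · rw [tw0_apply_zero]; exact hg
  · rw [tw0_apply_of_ne g h]; exact Subgroup.one_mem _

omit [TopologicalSpace G] [IsTopologicalGroup G] [CompactSpace G] [MeasurableSpace G] [BorelSpace G] in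
/-- Inverting the twist: `tw0 g⁻¹ = update 1 0 g⁻¹` and `(g^e)⁻¹ = (g⁻¹)^e`. -/
theorem tw0_pow_inv (g : G) (e : ℕ) : Function.update (1 : Fin 4 → G) 0 (g ^ e)⁻¹ = tw0 (g⁻¹ ^ e) := by
  rw [tw0, inv_pow]

variable {N : ℕ}

/-- **`P0`** — the direction-`0`-NEUTRAL partition function: the average over the powers of `g` of the `(0,3)`-twisted partition
functions, `P0 = n⁻¹ Σ_{e<n} Z^{(gᵉ on (0,3))}(a,b,c,d)` (for `g` of order `n` generating `Γ ≤ Z(G)`: the trace of `T^d` over the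
electric-flux sectors with `ψ_e(g) = 1`, 't Hooft 1979 (5.2)–(5.4) in one direction). -/
def P0 (ρ : G →* Matrix (Fin N) (Fin N) ℂ) (β : ℝ) (g : G) (n : ℕ) (a b c d : ℕ) : ℝ :=
  (n : ℝ)⁻¹ * ∑ e : Fin n, wilsonFinTorusTwistedPartition ρ β (tw0 (g ^ (e : ℕ))) a b c d

/-- **`u0`** — the FLUX WEIGHT of the plane `(0,3)`: `u0 = 1 − P0∕Z` (the Gibbs weight of the direction-`0`-charged electric flux
sectors; `= n⁻¹ Σ_e (1 − Z^{(gᵉ)}∕Z)`, the average twist cost). -/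
def u0 (ρ : G →* Matrix (Fin N) (Fin N) ℂ) (β : ℝ) (g : G) (n : ℕ) (a b c d : ℕ) : ℝ :=
  1 - P0 ρ β g n a b c d / wilsonFinTorusPartition ρ β a b c d

/-- **(Σ) at one coupling — FLUX-SECTOR SUB-MULTIPLICATIVITY IN TIME** (the located first lemma of the line): doubling the
Euclidean time does not increase the charged weight beyond its square, `Z(a,b,c,2d) − P0(a,b,c,2d) ≤ (Z(a,b,c,d) − P0(a,b,c,d))²`
(`Tr Π_c T^{2d} ≤ (Tr Π_c T^d)²` for the positive transfer matrix `T` of the slice `a×b×c` and the spectral projection `Π_c` onto the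
direction-`0`-charged flux sectors, which commutes with `T`). -/
def FluxSubmultAt (ρ : G →* Matrix (Fin N) (Fin N) ℂ) (β : ℝ) (g : G) (n : ℕ) : Prop :=
  ∀ a b c d : ℕ, 1 ≤ a → 1 ≤ b → 1 ≤ c → 2 ≤ d →
    wilsonFinTorusPartition ρ β a b c (2 * d) - P0 ρ β g n a b c (2 * d) ≤
      (wilsonFinTorusPartition ρ β a b c d - P0 ρ β g n a b c d) ^ 2

variable [SecondCountableTopology G] {ρ : G →* Matrix (Fin N) (Fin N) ℂ}

/-- `P0 > 0` (`0 < n`). -/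
theorem P0_pos (hρ : Continuous ρ) (β : ℝ) (g : G) {n : ℕ} (hn : 0 < n) (a b c d : ℕ) :
    0 < P0 ρ β g n a b c d := by
  unfold P0
  haveI : Nonempty (Fin n) := ⟨⟨0, hn⟩⟩
  refine mul_pos (inv_pos.2 (by exact_mod_cast hn)) (Finset.sum_pos (fun e _ => ?_) Finset.univ_nonempty)
  exact wilsonFinTorusTwistedPartition_pos ρ hρ β _ a b c d

/-- `P0 ≤ Z` (`β ≥ 0`, central `g`, time `≥ 2`): every central temporal twist never raises `Z` (`TwistCost.twistedPartition_le`). -/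
theorem P0_le_Z (hρ : Continuous ρ) (hρu : ∀ x, ρ x ∈ Matrix.unitaryGroup (Fin N) ℂ) {β : ℝ} (hβ : 0 ≤ β)
    {g : G} (hg : g ∈ Subgroup.center G) {n : ℕ} (hn : 0 < n) (a b c : ℕ) {d : ℕ} (hd : 2 ≤ d) :
    P0 ρ β g n a b c d ≤ wilsonFinTorusPartition ρ β a b c d := by
  obtain ⟨m, rfl⟩ : ∃ m, d = m + 2 := ⟨d - 2, by omega⟩
  unfold P0
  have hle : ∀ e : Fin n, wilsonFinTorusTwistedPartition ρ β (tw0 (g ^ (e : ℕ))) a b c (m + 2) ≤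
      wilsonFinTorusPartition ρ β a b c (m + 2) := fun e =>
    twistedPartition_le hρ hρu hβ a b c m (tw0_center (Subgroup.pow_mem _ hg _))
  have hn' : (0 : ℝ) < n := by exact_mod_cast hn
  calc (n : ℝ)⁻¹ * ∑ e : Fin n, wilsonFinTorusTwistedPartition ρ β (tw0 (g ^ (e : ℕ))) a b c (m + 2)
      ≤ (n : ℝ)⁻¹ * ∑ _e : Fin n, wilsonFinTorusPartition ρ β a b c (m + 2) :=
        mul_le_mul_of_nonneg_left (Finset.sum_le_sum fun e _ => hle e) (inv_nonneg.2 hn'.le)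
    _ = wilsonFinTorusPartition ρ β a b c (m + 2) := by
        rw [Finset.sum_const, Finset.card_univ, Fintype.card_fin, nsmul_eq_mul, ← mul_assoc,
          inv_mul_cancel₀ hn'.ne', one_mul]

/-- `0 ≤ u0` (`β ≥ 0`, central `g`, time `≥ 2`). -/
theorem u0_nonneg (hρ : Continuous ρ) (hρu : ∀ x, ρ x ∈ Matrix.unitaryGroup (Fin N) ℂ) {β : ℝ} (hβ : 0 ≤ β)
    {g : G} (hg : g ∈ Subgroup.center G) {n : ℕ} (hn : 0 < n) (a b c : ℕ) {d : ℕ} (hd : 2 ≤ d) :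
    0 ≤ u0 ρ β g n a b c d := by
  unfold u0
  rw [sub_nonneg, div_le_one (wilsonFinTorusPartition_pos hρ β a b c d)]
  exact P0_le_Z hρ hρu hβ hg hn a b c hd

/-- **The flux weight is below the margin**: if every central temporal twist of the box costs at most the fraction `η`, then
`u0 ≤ η` (the average of the costs of the powers `gᵉ`). -/
theorem u0_le_of_margins (hρ : Continuous ρ) (β : ℝ) {g : G} (hg : g ∈ Subgroup.center G) {n : ℕ} (hn : 0 < n)
    (a b c d : ℕ) {η : ℝ}
    (hm : ∀ z : Fin 4 → G, (∀ μ, z μ ∈ Subgroup.center G) →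
      1 - wilsonFinTorusTwistedPartition ρ β z a b c d / wilsonFinTorusPartition ρ β a b c d ≤ η) :
    u0 ρ β g n a b c d ≤ η := by
  have hZ := wilsonFinTorusPartition_pos hρ β a b c d
  have hn' : (0 : ℝ) < n := by exact_mod_cast hn
  have he : ∀ e : Fin n, 1 - wilsonFinTorusTwistedPartition ρ β (tw0 (g ^ (e : ℕ))) a b c d /
      wilsonFinTorusPartition ρ β a b c d ≤ η := fun e => hm _ (tw0_center (Subgroup.pow_mem _ hg _))
  have hsum : ∑ e : Fin n, (1 - wilsonFinTorusTwistedPartition ρ β (tw0 (g ^ (e : ℕ))) a b c d /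
      wilsonFinTorusPartition ρ β a b c d) ≤ ∑ _e : Fin n, η := Finset.sum_le_sum fun e _ => he e
  rw [Finset.sum_const, Finset.card_univ, Fintype.card_fin, nsmul_eq_mul, Finset.sum_sub_distrib, Finset.sum_const,
    Finset.card_univ, Fintype.card_fin, nsmul_eq_mul, mul_one, ← Finset.sum_div] at hsum
  unfold u0 P0
  have key : 1 - (n : ℝ)⁻¹ * (∑ e : Fin n, wilsonFinTorusTwistedPartition ρ β (tw0 (g ^ (e : ℕ))) a b c d) /
      wilsonFinTorusPartition ρ β a b c d =
      (n : ℝ)⁻¹ * ((n : ℝ) - (∑ e : Fin n, wilsonFinTorusTwistedPartition ρ β (tw0 (g ^ (e : ℕ))) a b c d) /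
        wilsonFinTorusPartition ρ β a b c d) := by
    field_simp
  rw [key]
  calc (n : ℝ)⁻¹ * ((n : ℝ) - (∑ e : Fin n, wilsonFinTorusTwistedPartition ρ β (tw0 (g ^ (e : ℕ))) a b c d) /
        wilsonFinTorusPartition ρ β a b c d) ≤ (n : ℝ)⁻¹ * ((n : ℝ) * η) :=
        mul_le_mul_of_nonneg_left hsum (inv_nonneg.2 hn'.le)
    _ = η := by field_simp

/-- **Reading the `(0,3)` plane along axis `0`**: `P0_g(a,b,c,d) = P0_{g⁻¹}(d,b,c,a)` (exchange of the axes `0 ↔ 3`,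
`wilsonFinTorusTwistedPartition_swap03_update`). -/
theorem P0_swap03 (hρ : Continuous ρ) (β : ℝ) (g : G) (n : ℕ) (a b c d : ℕ) :
    P0 ρ β g n a b c d = P0 ρ β g⁻¹ n d b c a := by
  unfold P0
  congr 1
  refine Finset.sum_congr rfl fun e _ => ?_
  rw [tw0, wilsonFinTorusTwistedPartition_swap03_update ρ hρ β, tw0_pow_inv]

/-- `u0_g(a,b,c,d) = u0_{g⁻¹}(d,b,c,a)`. -/
theorem u0_swap03 (hρ : Continuous ρ) (β : ℝ) (g : G) (n : ℕ) (a b c d : ℕ) :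
    u0 ρ β g n a b c d = u0 ρ β g⁻¹ n d b c a := by
  unfold u0
  rw [P0_swap03 hρ, wilsonFinTorusPartition_swap03 ρ hρ β a b c d]

/-! ## §C Untwisted doubling never beats squaring, along every axis (PROVED: spectral data of the slice) -/

/-- `Z(a,b,c,2d) ≤ Z(a,b,c,d)²` (`d ≥ 2`, `β ≥ 0`): `Σ λᵢ^{2d} ≤ (Σ λᵢ^d)²`, anisotropic slice. -/
theorem Z_double3_le_sq (hρ : Continuous ρ) (hρu : ∀ x, ρ x ∈ Matrix.unitaryGroup (Fin N) ℂ) {β : ℝ} (hβ : 0 ≤ β)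
    (a b c : ℕ) {d : ℕ} (hd : 2 ≤ d) :
    wilsonFinTorusPartition ρ β a b c (2 * d) ≤ wilsonFinTorusPartition ρ β a b c d ^ 2 := by
  obtain ⟨s, _, lam, i₀, hle, -, -, hZ⟩ := exists_spectralData_wilsonFinTorusPartition_box hρ hρu hβ a b c
  obtain ⟨m, rfl⟩ : ∃ m, d = m + 2 := ⟨d - 2, by omega⟩
  have h1 := hZ m
  have h2 : HasSum (fun i => (lam i ^ (m + 2)) ^ 2) (wilsonFinTorusPartition ρ β a b c (2 * (m + 2))) := by
    have h := hZ (2 * m + 2)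
    rw [show 2 * m + 2 + 2 = 2 * (m + 2) from by ring] at h
    refine h.congr_fun fun i => ?_
    rw [← pow_mul, mul_comm]
  exact hasSum_sq_le_sq (fun i => pow_nonneg (hle i).1 _) h1 h2

/-- `Z(2a,b,c,d) ≤ Z(a,b,c,d)²` (`a ≥ 2`). -/
theorem Z_double0_le_sq (hρ : Continuous ρ) (hρu : ∀ x, ρ x ∈ Matrix.unitaryGroup (Fin N) ℂ) {β : ℝ} (hβ : 0 ≤ β)
    {a : ℕ} (ha : 2 ≤ a) (b c d : ℕ) :
    wilsonFinTorusPartition ρ β (2 * a) b c d ≤ wilsonFinTorusPartition ρ β a b c d ^ 2 := by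
  rw [wilsonFinTorusPartition_swap03 ρ hρ β (2 * a) b c d, wilsonFinTorusPartition_swap03 ρ hρ β a b c d]
  exact Z_double3_le_sq hρ hρu hβ d b c ha

/-- `Z(a,2b,c,d) ≤ Z(a,b,c,d)²` (`b ≥ 2`). -/
theorem Z_double1_le_sq (hρ : Continuous ρ) (hρu : ∀ x, ρ x ∈ Matrix.unitaryGroup (Fin N) ℂ) {β : ℝ} (hβ : 0 ≤ β)
    (a : ℕ) {b : ℕ} (hb : 2 ≤ b) (c d : ℕ) :
    wilsonFinTorusPartition ρ β a (2 * b) c d ≤ wilsonFinTorusPartition ρ β a b c d ^ 2 := by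
  rw [wilsonFinTorusPartition_swap01 ρ hρ β a (2 * b) c d, wilsonFinTorusPartition_swap01 ρ hρ β a b c d]
  exact Z_double0_le_sq hρ hρu hβ hb a c d

/-- `Z(a,b,2c,d) ≤ Z(a,b,c,d)²` (`c ≥ 2`). -/
theorem Z_double2_le_sq (hρ : Continuous ρ) (hρu : ∀ x, ρ x ∈ Matrix.unitaryGroup (Fin N) ℂ) {β : ℝ} (hβ : 0 ≤ β)
    (a b : ℕ) {c : ℕ} (hc : 2 ≤ c) (d : ℕ) :
    wilsonFinTorusPartition ρ β a b (2 * c) d ≤ wilsonFinTorusPartition ρ β a b c d ^ 2 := by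
  rw [wilsonFinTorusPartition_swap02 ρ hρ β a b (2 * c) d, wilsonFinTorusPartition_swap02 ρ hρ β a b c d]
  exact Z_double0_le_sq hρ hρu hβ hc b a d

/-! ## §D The four doubling laws of the flux weight (plane `(0,3)`) -/

/-- ★ **TRANSVERSE LAW, axis 1 (PROVED unconditionally)**: doubling a side transverse to the twisted plane at most doubles the flux
weight, up to the twisted doubling defect `e`: `(1 − e)·P0(a,b,c,d)² ≤ P0(a,2b,c,d)` ⟹ `u0(a,2b,c,d) ≤ 2·u0(a,b,c,d) + e`. -/
theorem u0_transverse1 (hρ : Continuous ρ) (hρu : ∀ x, ρ x ∈ Matrix.unitaryGroup (Fin N) ℂ) {β : ℝ} (hβ : 0 ≤ β)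
    {g : G} (hg : g ∈ Subgroup.center G) {n : ℕ} (hn : 0 < n) (a : ℕ) {b : ℕ} (hb : 2 ≤ b) (c : ℕ) {d : ℕ}
    (hd : 2 ≤ d) {e : ℝ} (he : 0 ≤ e) (hres : (1 - e) * P0 ρ β g n a b c d ^ 2 ≤ P0 ρ β g n a (2 * b) c d) :
    u0 ρ β g n a (2 * b) c d ≤ 2 * u0 ρ β g n a b c d + e :=
  arith_transverse (wilsonFinTorusPartition_pos hρ β a b c d) (wilsonFinTorusPartition_pos hρ β a (2 * b) c d)
    (P0_pos hρ β g hn a b c d).le (P0_le_Z hρ hρu hβ hg hn a b c hd) (P0_pos hρ β g hn a (2 * b) c d).le he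
    (Z_double1_le_sq hρ hρu hβ a hb c d) hres

/-- ★ **TRANSVERSE LAW, axis 2 (PROVED unconditionally)**: `u0(a,b,2c,d) ≤ 2·u0(a,b,c,d) + e`. -/
theorem u0_transverse2 (hρ : Continuous ρ) (hρu : ∀ x, ρ x ∈ Matrix.unitaryGroup (Fin N) ℂ) {β : ℝ} (hβ : 0 ≤ β)
    {g : G} (hg : g ∈ Subgroup.center G) {n : ℕ} (hn : 0 < n) (a b : ℕ) {c : ℕ} (hc : 2 ≤ c) {d : ℕ}
    (hd : 2 ≤ d) {e : ℝ} (he : 0 ≤ e) (hres : (1 - e) * P0 ρ β g n a b c d ^ 2 ≤ P0 ρ β g n a b (2 * c) d) :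
    u0 ρ β g n a b (2 * c) d ≤ 2 * u0 ρ β g n a b c d + e :=
  arith_transverse (wilsonFinTorusPartition_pos hρ β a b c d) (wilsonFinTorusPartition_pos hρ β a b (2 * c) d)
    (P0_pos hρ β g hn a b c d).le (P0_le_Z hρ hρu hβ hg hn a b c hd) (P0_pos hρ β g hn a b (2 * c) d).le he
    (Z_double2_le_sq hρ hρu hβ a b hc d) hres

/-- ★★ **IN-PLANE LAW, time (from (Σ))**: doubling the Euclidean time SQUARES the flux weight up to the untwisted doubling ratio:
`Z(a,b,c,d)² ≤ 𝒩·Z(a,b,c,2d)` ⟹ `u0(a,b,c,2d) ≤ u0(a,b,c,d)²·𝒩` — the area law as a recursion. -/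
theorem u0_time_sq (hρ : Continuous ρ) {β : ℝ} {g : G} {n : ℕ} (hSub : FluxSubmultAt ρ β g n)
    {a b c d : ℕ} (ha : 1 ≤ a) (hb : 1 ≤ b) (hc : 1 ≤ c) (hd : 2 ≤ d) {𝒩 : ℝ}
    (hres : wilsonFinTorusPartition ρ β a b c d ^ 2 ≤ 𝒩 * wilsonFinTorusPartition ρ β a b c (2 * d)) :
    u0 ρ β g n a b c (2 * d) ≤ u0 ρ β g n a b c d ^ 2 * 𝒩 :=
  arith_inplane (wilsonFinTorusPartition_pos hρ β a b c d) (wilsonFinTorusPartition_pos hρ β a b c (2 * d))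
    (hSub a b c d ha hb hc hd) hres

/-- ★★ **IN-PLANE LAW, axis 0 (from (Σ) for `g⁻¹`, read along axis `0`)**: `Z(a,b,c,d)² ≤ 𝒩·Z(2a,b,c,d)` ⟹
`u0(2a,b,c,d) ≤ u0(a,b,c,d)²·𝒩`. -/
theorem u0_space_sq (hρ : Continuous ρ) {β : ℝ} {g : G} {n : ℕ} (hSub : FluxSubmultAt ρ β g⁻¹ n)
    {a b c d : ℕ} (ha : 2 ≤ a) (hb : 1 ≤ b) (hc : 1 ≤ c) (hd : 1 ≤ d) {𝒩 : ℝ}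
    (hres : wilsonFinTorusPartition ρ β a b c d ^ 2 ≤ 𝒩 * wilsonFinTorusPartition ρ β (2 * a) b c d) :
    u0 ρ β g n (2 * a) b c d ≤ u0 ρ β g n a b c d ^ 2 * 𝒩 := by
  rw [u0_swap03 hρ β g n (2 * a), u0_swap03 hρ β g n a]
  rw [wilsonFinTorusPartition_swap03 ρ hρ β a b c d, wilsonFinTorusPartition_swap03 ρ hρ β (2 * a) b c d] at hres
  exact u0_time_sq hρ hSub hd hb hc ha hres

/-- ★★★ **ONE OCTAVE** (base box `(L,L,L,t)`, schedule: time `t→2t`, axis 1, axis 2, axis 0): with `u := u0(L,L,L,t)`,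
half-purity of the base box in time (R1), transverse twisted-doubling defects `≤ u + e` (R2, R3), `6∕5`-purity of the last in-plane
doubling (R4), and (Σ) for `g`, `g⁻¹`: `u0(2L,2L,2L,2t) ≤ (8u² + 3u + 3e)²·6∕5`. -/
theorem u0_octave (hρ : Continuous ρ) (hρu : ∀ x, ρ x ∈ Matrix.unitaryGroup (Fin N) ℂ) {β : ℝ} (hβ : 0 ≤ β)
    {g : G} (hg : g ∈ Subgroup.center G) {n : ℕ} (hn : 0 < n) (hSub : FluxSubmultAt ρ β g n)
    (hSubInv : FluxSubmultAt ρ β g⁻¹ n) {L t : ℕ} (hL : 2 ≤ L) (ht : 2 ≤ t) {e : ℝ} (he : 0 ≤ e)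
    (R1 : wilsonFinTorusPartition ρ β L L L t ^ 2 ≤ 2 * wilsonFinTorusPartition ρ β L L L (2 * t))
    (R2 : (1 - (u0 ρ β g n L L L t + e)) * P0 ρ β g n L L L (2 * t) ^ 2 ≤ P0 ρ β g n L (2 * L) L (2 * t))
    (R3 : (1 - (u0 ρ β g n L L L t + e)) * P0 ρ β g n L (2 * L) L (2 * t) ^ 2 ≤
      P0 ρ β g n L (2 * L) (2 * L) (2 * t))
    (R4 : wilsonFinTorusPartition ρ β L (2 * L) (2 * L) (2 * t) ^ 2 ≤
      (6 / 5) * wilsonFinTorusPartition ρ β (2 * L) (2 * L) (2 * L) (2 * t)) :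
    u0 ρ β g n (2 * L) (2 * L) (2 * L) (2 * t) ≤
      (8 * u0 ρ β g n L L L t ^ 2 + 3 * u0 ρ β g n L L L t + 3 * e) ^ 2 * (6 / 5) := by
  have hL1 : 1 ≤ L := by omega
  have h2L : 1 ≤ 2 * L := by omega
  have h2t : 2 ≤ 2 * t := by omega
  have hu : 0 ≤ u0 ρ β g n L L L t := u0_nonneg hρ hρu hβ hg hn L L L ht
  have hue : 0 ≤ u0 ρ β g n L L L t + e := add_nonneg hu he
  have h1 := u0_time_sq hρ hSub hL1 hL1 hL1 ht R1
  have h2 := u0_transverse1 hρ hρu hβ hg hn L hL L h2t hue R2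
  have h3 := u0_transverse2 hρ hρu hβ hg hn L (2 * L) hL h2t hue R3
  have h4 := u0_space_sq hρ hSubInv hL h2L h2L (by omega : 1 ≤ 2 * t) R4
  have hu₃ : 0 ≤ u0 ρ β g n L (2 * L) (2 * L) (2 * t) := u0_nonneg hρ hρu hβ hg hn _ _ _ h2t
  exact arith_octave hu hu₃ he h1 h2 h3 h4

/-- ★ **THE SEAM `F ∧ V ⇒ THE NUMBER`** (PROVED): at a cold `4:1` box `(4t)³ × t`, neutral purity
`(1 − θ)·P0(t)² ≤ P0(2t)` and flux weight `u = u0(4t,4t,4t,t)` give `coldDefect ≤ θ + 2u`. -/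
theorem coldDefect_le_of_neutralPure (hρ : Continuous ρ) (hρu : ∀ x, ρ x ∈ Matrix.unitaryGroup (Fin N) ℂ) {β : ℝ}
    (hβ : 0 ≤ β) {g : G} (hg : g ∈ Subgroup.center G) {n : ℕ} (hn : 0 < n) {t : ℕ} (ht : 2 ≤ t) {θ : ℝ} (hθ : 0 ≤ θ)
    (hV : (1 - θ) * P0 ρ β g n (4 * t) (4 * t) (4 * t) t ^ 2 ≤ P0 ρ β g n (4 * t) (4 * t) (4 * t) (2 * t)) :
    coldDefect ρ β (4 * t) ≤ θ + 2 * u0 ρ β g n (4 * t) (4 * t) (4 * t) t := by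
  have h4 : 4 * t / 4 = t := by omega
  unfold coldDefect u0
  rw [h4]
  exact arith_seam (wilsonFinTorusPartition_pos hρ β _ _ _ _) (P0_pos hρ β g hn _ _ _ _).le
    (P0_le_Z hρ hρu hβ hg hn _ _ _ ht) (P0_le_Z hρ hρu hβ hg hn _ _ _ (by omega)) hθ hV

end Currency

/-! ## §E The pieces (typed hypotheses, no `sorry`) and the slot -/

/-- **PXcof(θ)** — VERBATIM the slot body `PinnedCofinalBill.PinnedExitsCofinalAt θ` of the line of record
(`Cruxes/IRcof/Lines/pinned_cofinal_bill.lean`; restated, not imported, so that no `sorry` enters this sheet). -/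
def PXcof (θ : ℝ) : Prop :=
  ∀ (G : Type) [Group G] [TopologicalSpace G] [IsTopologicalGroup G] [CompactSpace G],
    IsCompactSimpleLieGroup G → SimplyConnectedSpace G →
    letI : MeasurableSpace G := borel G
    haveI : BorelSpace G := ⟨rfl⟩
    ∀ (r : LatticeRep G) (a : ℝ → ℝ), (∀ β, 0 < a β) → Tendsto a atTop (𝓝 0) → LowerBounds G r a →
      ∃ T : ℝ, ∀ β₁ : ℝ, ∃ β : ℝ, β₁ ≤ β ∧ ∃ L : ℕ, 8 ≤ L ∧ a β * (L : ℝ) ≤ T ∧ coldDefect r.ρ β L ≤ θ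

/-- **(S) SEED — the ignition: ONE `1∕32`-margin-confined cold `4:1` box, cofinally, pinned in fm, at a scale `4 ∣ L`.**
VERBATIM SHAPE of row 42's (CU) `DeconfinementRuler.PinnedConfinedCofinal (1/32)` with the extra conjunct `4 ∣ L`: for every
simply-connected compact simple `G`, every `r`, every positive unit map `a → 0` with the floor `LowerBounds G r a`, there is `T`
such that for every `β₁` some `β ≥ β₁` has a box `L³ × L∕4`, `8 ≤ L`, `4 ∣ L`, `a(β)·L ≤ T`, in which EVERY central temporal twist
costs at most the fraction `1∕32` of `Z`.  UNDECIDED (E-type; the located femto→bulk CROSSING in flux currency: margin confinement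
fails on femto boxes and on the whole `4:1` family below the deconfinement length, holds above it). -/
def Seed : Prop :=
  ∀ (G : Type) [Group G] [TopologicalSpace G] [IsTopologicalGroup G] [CompactSpace G],
    IsCompactSimpleLieGroup G → SimplyConnectedSpace G →
    letI : MeasurableSpace G := borel G
    haveI : BorelSpace G := ⟨rfl⟩
    ∀ (r : LatticeRep G) (a : ℝ → ℝ), (∀ β, 0 < a β) → Tendsto a atTop (𝓝 0) → LowerBounds G r a →
      ∃ T : ℝ, ∀ β₁ : ℝ, ∃ β : ℝ, β₁ ≤ β ∧ ∃ L : ℕ, 8 ≤ L ∧ 4 ∣ L ∧ a β * (L : ℝ) ≤ T ∧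
        ∀ z : Fin 4 → G, (∀ μ, z μ ∈ Subgroup.center G) →
          1 - wilsonFinTorusTwistedPartition r.ρ β z L L L (L / 4) / wilsonFinTorusPartition r.ρ β L L L (L / 4) ≤
            (1 / 32 : ℝ)

/-- **(Σ) FLUX-SECTOR SUB-MULTIPLICATIVITY** (the located first lemma, on the class): for `β ≥ 0` and every central `g` with
`gⁿ = 1`, `0 < n`: `FluxSubmultAt r.ρ β g n`.  ATTACKABLE (M): operator positivity of the transfer matrix on the charged sectors;
group-blind, width 0. -/
def FluxSubmult : Prop :=
  ∀ (G : Type) [Group G] [TopologicalSpace G] [IsTopologicalGroup G] [CompactSpace G],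
    IsCompactSimpleLieGroup G → SimplyConnectedSpace G →
    letI : MeasurableSpace G := borel G
    haveI : BorelSpace G := ⟨rfl⟩
    ∀ (r : LatticeRep G) (β : ℝ), 0 ≤ β → ∀ g ∈ Subgroup.center G, ∀ n : ℕ, 0 < n → g ^ n = 1 →
      FluxSubmultAt r.ρ β g n

/-- **(R) LADDER RESIDUALS above a margin-confined box** (per `G`, `r`, nontrivial central `g` of exponent `n`, eventually in `β`,
for EVERY base box `(4t)³ × t` whose flux weight is already `≤ 1∕32`): (R1) the base box is half-pure in time,
`Z(t)² ≤ 2·Z(2t)`; (R2),(R3) the two transverse doublings of the twisted-averaged box have defect `≤ u + 10⁻³`; (R4) the last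
in-plane spatial doubling is `6∕5`-pure.  UNDECIDED; near-wall only at the seed octave (Polyakov-sector proximity), idle above. -/
def Residuals : Prop :=
  ∀ (G : Type) [Group G] [TopologicalSpace G] [IsTopologicalGroup G] [CompactSpace G],
    IsCompactSimpleLieGroup G → SimplyConnectedSpace G →
    letI : MeasurableSpace G := borel G
    haveI : BorelSpace G := ⟨rfl⟩
    ∀ (r : LatticeRep G), ∀ g ∈ Subgroup.center G, g ≠ 1 → ∀ n : ℕ, 0 < n → g ^ n = 1 →
      ∃ β₀ : ℝ, ∀ β : ℝ, β₀ ≤ β → ∀ t : ℕ, 2 ≤ t →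
        u0 r.ρ β g n (4 * t) (4 * t) (4 * t) t ≤ 1 / 32 →
          wilsonFinTorusPartition r.ρ β (4 * t) (4 * t) (4 * t) t ^ 2 ≤
              2 * wilsonFinTorusPartition r.ρ β (4 * t) (4 * t) (4 * t) (2 * t) ∧
          (1 - (u0 r.ρ β g n (4 * t) (4 * t) (4 * t) t + 1 / 1000)) *
              P0 r.ρ β g n (4 * t) (4 * t) (4 * t) (2 * t) ^ 2 ≤ P0 r.ρ β g n (4 * t) (2 * (4 * t)) (4 * t) (2 * t) ∧
          (1 - (u0 r.ρ β g n (4 * t) (4 * t) (4 * t) t + 1 / 1000)) *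
              P0 r.ρ β g n (4 * t) (2 * (4 * t)) (4 * t) (2 * t) ^ 2 ≤
            P0 r.ρ β g n (4 * t) (2 * (4 * t)) (2 * (4 * t)) (2 * t) ∧
          wilsonFinTorusPartition r.ρ β (4 * t) (2 * (4 * t)) (2 * (4 * t)) (2 * t) ^ 2 ≤
            (6 / 5) * wilsonFinTorusPartition r.ρ β (2 * (4 * t)) (2 * (4 * t)) (2 * (4 * t)) (2 * t)

/-- **(V) NEUTRAL PURITY where the flux is already gone** (per `G`, `r`, nontrivial central `g` of exponent `n`, eventually in `β`):
every cold `4:1` box `(4t)³ × t` whose flux weight is `≤ 1∕400` has a `1∕60`-pure direction-`0`-NEUTRAL sector,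
`(1 − 1∕60)·P0(t)² ≤ P0(2t)`.  UNDECIDED (E-type: the glueball gap of the neutral sector times the box; CENTRE-BLIND — the
centre-free groups' whole NUMBER is of this kind, X11). -/
def NeutralPure : Prop :=
  ∀ (G : Type) [Group G] [TopologicalSpace G] [IsTopologicalGroup G] [CompactSpace G],
    IsCompactSimpleLieGroup G → SimplyConnectedSpace G →
    letI : MeasurableSpace G := borel G
    haveI : BorelSpace G := ⟨rfl⟩
    ∀ (r : LatticeRep G), ∀ g ∈ Subgroup.center G, g ≠ 1 → ∀ n : ℕ, 0 < n → g ^ n = 1 →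
      ∃ β₀ : ℝ, ∀ β : ℝ, β₀ ≤ β → ∀ t : ℕ, 2 ≤ t →
        u0 r.ρ β g n (4 * t) (4 * t) (4 * t) t ≤ 1 / 400 →
          (1 - 1 / 60) * P0 r.ρ β g n (4 * t) (4 * t) (4 * t) t ^ 2 ≤ P0 r.ρ β g n (4 * t) (4 * t) (4 * t) (2 * t)

/-- **(CF) THE CENTRE-FREE RESIDUAL** — PXcof(1∕24) itself for the groups with trivial centre (`G₂`, `F₄`, `E₈`), where no
't Hooft flux exists and this lens has no purchase (row 13's `CentreFreeResidual`, X11).  BARRIER-class, imported by name-shape. -/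
def CentreFreePX : Prop :=
  ∀ (G : Type) [Group G] [TopologicalSpace G] [IsTopologicalGroup G] [CompactSpace G],
    IsCompactSimpleLieGroup G → SimplyConnectedSpace G → Subgroup.center G = ⊥ →
    letI : MeasurableSpace G := borel G
    haveI : BorelSpace G := ⟨rfl⟩
    ∀ (r : LatticeRep G) (a : ℝ → ℝ), (∀ β, 0 < a β) → Tendsto a atTop (𝓝 0) → LowerBounds G r a →
      ∃ T : ℝ, ∀ β₁ : ℝ, ∃ β : ℝ, β₁ ≤ β ∧ ∃ L : ℕ, 8 ≤ L ∧ a β * (L : ℝ) ≤ T ∧ coldDefect r.ρ β L ≤ (1 / 24 : ℝ)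

/-! ## §F The composition: five octaves of the squaring ladder above the seed box give THE NUMBER -/

/-- ★★★ **`Seed → FluxSubmult → Residuals → NeutralPure → CentreFreePX → PXcof(1∕24)`** (PROVED plumbing).  Nontrivial centre:
pick a central `g ≠ 1` (finite order, `CentreFinite`); at the seed's pinned `1∕32`-margin-confined box `(4t)³×t` the flux weight is
`u_0 ≤ 1∕32`; by `u0_octave` + `arith_contract` + (R), `u_{k+1} ≤ u_k∕2 + 10⁻³∕2` along the boxes `(2ᵏ·4t)³ × 2ᵏt`, so
`u_5 ≤ 2⁻⁵∕32 + 10⁻³ ≤ 1∕400`; (V) and the seam give `coldDefect(2⁵·4t) ≤ 1∕60 + 2u_5 ≤ 1∕24`, pinned by `T = 32·T₀`.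
Trivial centre: (CF). -/
theorem pxcof24_of_pieces (hS : Seed) (hSub : FluxSubmult) (hR : Residuals) (hV : NeutralPure) (hCF : CentreFreePX) :
    PXcof (1 / 24) := by
  intro G _ _ _ _ hG hsc
  letI : MeasurableSpace G := borel G
  haveI : BorelSpace G := ⟨rfl⟩
  intro r a ha ha0 hlb
  haveI : SecondCountableTopology G :=
    (r.continuous.isClosedEmbedding r.injective).isEmbedding.secondCountableTopology
  by_cases hbot : Subgroup.center G = ⊥
  · exact hCF G hG hsc hbot r a ha ha0 hlb
  -- a nontrivial central element of finite order
  obtain ⟨g, hg, hg1⟩ : ∃ g ∈ Subgroup.center G, g ≠ 1 := by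
    by_contra h
    push_neg at h
    exact hbot ((Subgroup.eq_bot_iff_forall _).2 h)
  haveI : Finite (Subgroup.center G) := CentreFinite.finite_center_of_isCompactSimpleLieGroup hG
  set n : ℕ := orderOf (⟨g, hg⟩ : Subgroup.center G) with hn_def
  have hn : 0 < n := (isOfFinOrder_of_finite (⟨g, hg⟩ : Subgroup.center G)).orderOf_pos
  have hgn : g ^ n = 1 := by
    have h := pow_orderOf_eq_one (⟨g, hg⟩ : Subgroup.center G)
    rw [← hn_def] at h
    have h' := congrArg Subtype.val h
    simpa using h'
  have hg' : g⁻¹ ∈ Subgroup.center G := Subgroup.inv_mem _ hg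
  have hgn' : g⁻¹ ^ n = 1 := by rw [inv_pow, hgn, inv_one]
  -- the thresholds of (R) and (V), the seed
  obtain ⟨βR, hβR⟩ := hR G hG hsc r g hg hg1 n hn hgn
  obtain ⟨βV, hβV⟩ := hV G hG hsc r g hg hg1 n hn hgn
  obtain ⟨T₀, hseed⟩ := hS G hG hsc r a ha ha0 hlb
  refine ⟨32 * T₀, fun β₁ => ?_⟩
  obtain ⟨β, hβ₁, L, hL8, ⟨t, rfl⟩, hpin, hmargin⟩ := hseed (max (max β₁ 0) (max βR βV))
  have hβ0 : 0 ≤ β := le_trans (le_max_right _ _) ((le_max_left _ _).trans hβ₁)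
  have hβR' : βR ≤ β := le_trans (le_max_left _ _) ((le_max_right _ _).trans hβ₁)
  have hβV' : βV ≤ β := le_trans (le_max_right _ _) ((le_max_right _ _).trans hβ₁)
  have ht : 2 ≤ t := by omega
  have hρ := r.continuous
  have hρu := r.mem_unitary
  -- the flux weight along the ladder of boxes `(4·2ᵏt)³ × 2ᵏt`
  set f : ℕ → ℝ := fun k => u0 r.ρ β g n (4 * (2 ^ k * t)) (4 * (2 ^ k * t)) (4 * (2 ^ k * t)) (2 ^ k * t) with hf
  have h4t : 4 * t / 4 = t := by omega
  have hf0 : f 0 ≤ 1 / 32 := by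
    simp only [hf, pow_zero, one_mul]
    refine u0_le_of_margins hρ β hg hn _ _ _ _ fun z hz => ?_
    have h := hmargin z hz
    rwa [h4t] at h
  have hstep : ∀ k, f k ≤ 1 / 32 → f (k + 1) ≤ f k / 2 + (1 / 1000) / 2 := by
    intro k hk
    have htk : 2 ≤ 2 ^ k * t := le_trans ht (Nat.le_mul_of_pos_left t (Nat.two_pow_pos k))
    obtain ⟨R1, R2, R3, R4⟩ := hβR β hβR' (2 ^ k * t) htk hk
    have hoct := u0_octave hρ hρu hβ0 hg hn (hSub G hG hsc r β hβ0 g hg n hn hgn) (hSub G hG hsc r β hβ0 g⁻¹ hg' n hn hgn')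
      (L := 4 * (2 ^ k * t)) (t := 2 ^ k * t) (by omega) htk (by norm_num : (0 : ℝ) ≤ 1 / 1000) R1 R2 R3 R4
    have hu0 : 0 ≤ f k := u0_nonneg hρ hρu hβ0 hg hn _ _ _ htk
    have hcon := arith_contract hu0 hk (by norm_num : (0 : ℝ) ≤ 1 / 1000) le_rfl
    have e1 : 2 * (4 * (2 ^ k * t)) = 4 * (2 ^ (k + 1) * t) := by ring
    have e2 : 2 * (2 ^ k * t) = 2 ^ (k + 1) * t := by ring
    simp only [hf]
    rw [← e1, ← e2]
    exact hoct.trans hcon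
  have hinv : ∀ k, f k ≤ 1 / 32 ∧ f k ≤ (1 / 32) / 2 ^ k + 1 / 1000 := by
    intro k
    induction k with
    | zero => exact ⟨hf0, by rw [pow_zero, div_one]; linarith⟩
    | succ k ih =>
      have h := hstep k ih.1
      refine ⟨by linarith [ih.1], ?_⟩
      have : (1 / 32 : ℝ) / 2 ^ (k + 1) = ((1 / 32) / 2 ^ k) / 2 := by
        rw [pow_succ]; ring
      rw [this]
      linarith [ih.2]
  -- five octaves up: flux weight ≤ 1/400, neutral purity, the seam
  have h5 := (hinv 5).2
  have hf5 : f 5 ≤ 1 / 400 := by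
    have : (1 / 32 : ℝ) / 2 ^ 5 + 1 / 1000 ≤ 1 / 400 := by norm_num
    exact h5.trans this
  have ht5 : 2 ≤ 2 ^ 5 * t := by omega
  have hVt := hβV β hβV' (2 ^ 5 * t) ht5 hf5
  have hseam := coldDefect_le_of_neutralPure hρ hρu hβ0 hg hn ht5 (by norm_num : (0 : ℝ) ≤ 1 / 60) hVt
  refine ⟨β, le_trans (le_max_left _ _) ((le_max_left _ _).trans hβ₁), 4 * (2 ^ 5 * t), by omega, ?_, ?_⟩
  · have e3 : ((4 * (2 ^ 5 * t) : ℕ) : ℝ) = 32 * ((4 * t : ℕ) : ℝ) := by push_cast; ring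
    rw [e3, ← mul_assoc, mul_comm (a β) 32, mul_assoc]
    exact mul_le_mul_of_nonneg_left hpin (by norm_num)
  · have : (1 / 60 : ℝ) + 2 * f 5 ≤ 1 / 24 := by
      have : 2 * f 5 ≤ 2 * ((1 / 32 : ℝ) / 2 ^ 5 + 1 / 1000) := by linarith
      have hnum : (1 / 60 : ℝ) + 2 * ((1 / 32 : ℝ) / 2 ^ 5 + 1 / 1000) ≤ 1 / 24 := by norm_num
      linarith
    exact hseam.trans this

/-- ★★★ **The crux BY NAME: `… → IRnscCof → Summit.QuantumFields.YangMills.Theses.BalabanLadder.IRcof`** — PXcof(1∕24) from the five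
pieces, then the bill of record `PXcof(1∕24) → N_cof → IRcof` (simply-connected `G`: the landed X-free cofinal kernel
`PinnedExitCofinal.cofinalGapOn_of_pinnedExits`; `π₁(G) ≠ 1`: N_cof verbatim), exactly as `PinnedCofinalBill.IRcof_of`. -/
theorem IRcof_of_pieces (hS : Seed) (hSub : FluxSubmult) (hR : Residuals) (hV : NeutralPure) (hCF : CentreFreePX)
    (hN : IRnscCof) : Summit.QuantumFields.YangMills.Theses.BalabanLadder.IRcof := by
  have hP := pxcof24_of_pieces hS hSub hR hV hCF
  intro G _ _ _ _ hG
  letI : MeasurableSpace G := borel G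
  haveI : BorelSpace G := ⟨rfl⟩
  intro r a ha ha0 hlb
  by_cases hsc : SimplyConnectedSpace G
  · obtain ⟨T, hcof⟩ := hP G hG hsc r a ha ha0 hlb
    exact cofinalGapOn_of_pinnedExits r a ha ha0 hcof
  · exact hN G hG hsc r a ha ha0 hlb

/-! ## §G Certificates for the critic: (S) is (CU)-at-`4 ∣ L` (by shape), and (S) follows from PXcof at scales `4 ∣ L` via S1 -/

/-- **(S) ⇐ PXcof(1∕64) at scales `4 ∣ L`** (WEAKER-in-kind certificate): if the slot's pinned pure box can be taken with `4 ∣ L`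
and purity `1∕64`, the same box is `1∕32`-margin-confined (S1 `half_twist_cost_le_coldDefect`, via row 42's landed
`DeconfinementRuler.pinnedConfinedCofinal_of_pxcof` argument). -/
theorem seed_of_pxcof64_div4
    (hP : ∀ (G : Type) [Group G] [TopologicalSpace G] [IsTopologicalGroup G] [CompactSpace G],
      IsCompactSimpleLieGroup G → SimplyConnectedSpace G →
      letI : MeasurableSpace G := borel G
      haveI : BorelSpace G := ⟨rfl⟩
      ∀ (r : LatticeRep G) (a : ℝ → ℝ), (∀ β, 0 < a β) → Tendsto a atTop (𝓝 0) → LowerBounds G r a →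
        ∃ T : ℝ, ∀ β₁ : ℝ, ∃ β : ℝ, β₁ ≤ β ∧ ∃ L : ℕ, 8 ≤ L ∧ 4 ∣ L ∧ a β * (L : ℝ) ≤ T ∧
          coldDefect r.ρ β L ≤ (1 / 64 : ℝ)) :
    Seed := by
  intro G _ _ _ _ hG hsc
  letI : MeasurableSpace G := borel G
  haveI : BorelSpace G := ⟨rfl⟩
  intro r a ha ha0 hlb
  haveI : SecondCountableTopology G :=
    (r.continuous.isClosedEmbedding r.injective).isEmbedding.secondCountableTopology
  obtain ⟨T, hcof⟩ := hP G hG hsc r a ha ha0 hlb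
  refine ⟨T, fun β₁ => ?_⟩
  obtain ⟨β, hβ, L, hL, hdiv, hpin, hδ⟩ := hcof (max β₁ 0)
  refine ⟨β, (le_max_left _ _).trans hβ, L, hL, hdiv, hpin, fun z hz => ?_⟩
  have h := (Summit.QuantumFields.YangMills.Cruxes.IR.TwistCost.half_twist_cost_le_coldDefect r.continuous r.mem_unitary
    ((le_max_right _ _).trans hβ) hL hz).1
  linarith


/-! ## §H The plan for (Σ): it reduces to CENTRE-ADAPTED SPECTRAL DATA of the slice transfer operator (the one new lemma) -/

section SigmaPlan

variable {G : Type} [Group G] [TopologicalSpace G] [IsTopologicalGroup G] [CompactSpace G]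
  [MeasurableSpace G] [BorelSpace G] {N : ℕ}

/-- **Centre-adapted spectral data** of the slice `a×b×c` for `(ρ, β, g, n)`: nonnegative "eigenvalue moduli" `λᵢ` and WEIGHTS `wᵢ ∈ {0,1}`
(`wᵢ = 1` iff the eigenvector is fixed by the centre action of `g`, i.e. lies in a direction-`0`-neutral flux sector) with
`Σ λᵢ^{m+2} = Z(a,b,c,m+2)` and `Σ λᵢ^{m+2}·wᵢ = P0(a,b,c,m+2)` for every `m`.  THE STUB OF THE LINE — two routes, both inside the tree's
operator layer (`Literature.Analysis.OperatorTheory`, as used by `exists_eigenbasis_finTorusSliceKernel` / `TwistCost.twistedPartition_le`):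
(eigenspace route) simultaneous diagonalisation of the commuting unitary centre action `V` (composition with the measure-preserving slice twist
`finSliceTwist (tw0 g)`, `measurePreserving_finSliceTwist`) on the finite-dimensional eigenspaces `λ ≠ 0` of the compact self-adjoint transfer operator
`A` (`exists_kernelOp`, `isSelfAdjoint_kernelOp`, `isCompactOperator_kernelOp`, `exists_hilbertBasis_eigenvectors_of_isSelfAdjoint`), then the twisted
trace formula `Z^{(gᵉ)}(m+2) = Σ λᵢ^{m+2}⟨bᵢ, Vᵉ bᵢ⟩` (`wilsonFinTorusTwistedPartition_eq_integral_iterate` + `hasSum_pow_integral_iterate_diag`-type);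
(CHARGED-OPERATOR route, no simultaneous diagonalisation) `Π := n⁻¹ Σ_{e<n} Vᵉ` is an orthogonal projection commuting with `A` (kernel invariance
`K(τx, τy) = K(x, y)` for central twists), so `A' := A(1 − Π)` is again a compact self-adjoint KERNEL operator with bounded kernel
`K'(x,y) = K(x,y) − n⁻¹ Σ_e K(x, τᵉy)`, `(A')^{k} = A^{k}(1 − Π)`, and `∫ K'^{(m+2)}(x,x) = Z(m+2) − P0(m+2)`; an eigenbasis of `A'` gives the data with
all `wᵢ = 0` for `A'` directly (then `hasSum_sq_le_sq` is literally `wilsonFinTorusPartition_two_mul_le_sq`'s proof for `A'`).  Either way: no cluster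
expansion, no gap, no group theory — positivity of `T` and `[T, V] = 0` only. -/
def AdaptedSpectralDataAt (ρ : G →* Matrix (Fin N) (Fin N) ℂ) (β : ℝ) (g : G) (n : ℕ) (a b c : ℕ) : Prop :=
  ∃ (ι : Type) (lam w : ι → ℝ), (∀ i, 0 ≤ lam i) ∧ (∀ i, w i = 0 ∨ w i = 1) ∧
    (∀ m : ℕ, HasSum (fun i => lam i ^ (m + 2)) (wilsonFinTorusPartition ρ β a b c (m + 2))) ∧
    (∀ m : ℕ, HasSum (fun i => lam i ^ (m + 2) * w i) (P0 ρ β g n a b c (m + 2)))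

/-- ★ **(Σ) from adapted spectral data (PROVED)**: the charged family `aᵢ = λᵢ^{d}(1 − wᵢ)` has `aᵢ² = λᵢ^{2d}(1 − wᵢ)` because `wᵢ ∈ {0,1}`,
so `Z(2d) − P0(2d) = Σ aᵢ² ≤ (Σ aᵢ)² = (Z(d) − P0(d))²` (`hasSum_sq_le_sq`).  Hence the located lemma (Σ) IS the existence of adapted spectral data. -/
theorem fluxSubmultAt_of_adapted {ρ : G →* Matrix (Fin N) (Fin N) ℂ} {β : ℝ} {g : G} {n : ℕ}
    (h : ∀ a b c : ℕ, 1 ≤ a → 1 ≤ b → 1 ≤ c → AdaptedSpectralDataAt ρ β g n a b c) :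
    FluxSubmultAt ρ β g n := by
  intro a b c d ha hb hc hd
  obtain ⟨ι, lam, w, hlam, hw, hZ, hP⟩ := h a b c ha hb hc
  obtain ⟨m, rfl⟩ : ∃ m, d = m + 2 := ⟨d - 2, by omega⟩
  have hw01 : ∀ i, 0 ≤ 1 - w i ∧ (1 - w i) ^ 2 = 1 - w i := by
    intro i
    rcases hw i with h0 | h1
    · rw [h0]; norm_num
    · rw [h1]; norm_num
  -- the charged family and its square
  have hA : HasSum (fun i => lam i ^ (m + 2) * (1 - w i))
      (wilsonFinTorusPartition ρ β a b c (m + 2) - P0 ρ β g n a b c (m + 2)) := by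
    have := (hZ m).sub (hP m)
    refine this.congr_fun fun i => ?_
    ring
  have hB : HasSum (fun i => (lam i ^ (m + 2) * (1 - w i)) ^ 2)
      (wilsonFinTorusPartition ρ β a b c (2 * (m + 2)) - P0 ρ β g n a b c (2 * (m + 2))) := by
    have h2 := (hZ (2 * m + 2)).sub (hP (2 * m + 2))
    rw [show 2 * m + 2 + 2 = 2 * (m + 2) from by ring] at h2
    refine h2.congr_fun fun i => ?_
    show (lam i ^ (m + 2) * (1 - w i)) ^ 2 = lam i ^ (2 * m + 2 + 2) - lam i ^ (2 * m + 2 + 2) * w i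
    rw [mul_pow, (hw01 i).2, ← pow_mul, show (m + 2) * 2 = 2 * m + 2 + 2 from by ring]
    ring
  exact hasSum_sq_le_sq (fun i => mul_nonneg (pow_nonneg (hlam i) _) (hw01 i).1) hA hB

end SigmaPlan

end Summit.QuantumFields.YangMills.Cruxes.IRcof.FemtoBulkG2

end
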